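import Mathlib
import Literature.AlgebraicGeometry.Resolution.MuPTorsorLocalUniformizationRelative
import Literature.AlgebraicGeometry.Resolution.RegularLocalRingsProofs
import Literature.AlgebraicGeometry.Resolution.RootAdjunctionRegular
import Literature.AlgebraicGeometry.Resolution.RegularLocalRingsQuotient
import HarnessLib

/-!
# The simplest toroidal exit of the model-form `μ_p`-torsor step (Lemma T, one parameter)

Solo/informed residency, session 5; companion of `SoloInformedTorsorExits` (Lemma U). The
toroidal exit of the core step `RelMuPTorsorCoreStepsAt` treats presentations
`a ^ p = q ^ p + w · x₁^{b₁} ⋯ x_s^{b_s}` (`w` a unit, `x` regular parameters, `p ∤ b₁`) by the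
toric resolution of the normalised `p`-cover; its case `s = 1` needs no toric geometry:
**Lemma T₁.** `T` a regular local ring in a field `K` dominated by a valuation ring `O`,
`q, w, x ∈ T`, `w ∈ T^×`, `x ≠ 0`, `T/(x)` regular, `p ∤ b`, `a ^ p = q ^ p + w · x ^ b`. With
`α b = β p + 1` and `a′ := (a - q)^α / x^β` one has `a′ ^ p = w^α x`, and
`T[a′] ≅ T[Z]/(Z^p - w^α x)` is a regular local ring with maximal ideal `𝔪_T T[a′] + (a′)`
(Kummer covering along a regular parameter [Matsumura, 14.2]; cf. K. Kato, *Toric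
singularities* (1994) and the tree's `KummerChartLogRegular`) containing `a = q + w^{-β} a′^b`,
inside `Frac T (a)`, dominated by `O`: a model solving the step.
-/

noncomputable section

namespace Summit.ResolutionOfSingularities.ResolutionOfSingularities.Theorems

open Polynomial IsLocalRing Literature.AlgebraicGeometry.Resolution

universe u
section Kummer
variable {R : Type u} [CommRing R]

/-- `R[Z]/(Z^d - y) ⧸ (z) ≅ R ⧸ (y)` (`d ≥ 1`). [folklore] -/
theorem nonempty_ringEquiv_adjoinRoot_quotient_root (y : R) {d : ℕ} (hd : 0 < d) :
    Nonempty ((AdjoinRoot (X ^ d - C y : R[X]) ⧸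
      Ideal.span {AdjoinRoot.root (X ^ d - C y : R[X])}) ≃+* R ⧸ Ideal.span {y}) := by
  set g : R[X] := X ^ d - C y with hg
  have hev : g.eval₂ (Ideal.Quotient.mk (Ideal.span {y})) 0 = 0 := by
    rw [hg, eval₂_sub, eval₂_X_pow, eval₂_C, zero_pow hd.ne', zero_sub, neg_eq_zero,
      Ideal.Quotient.eq_zero_iff_mem]
    exact Ideal.mem_span_singleton_self y
  set φ : AdjoinRoot g →+* R ⧸ Ideal.span {y} :=
    AdjoinRoot.lift (Ideal.Quotient.mk (Ideal.span {y})) 0 hev with hφ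
  have hφof : ∀ r : R, φ (AdjoinRoot.of g r) = Ideal.Quotient.mk _ r := fun r => by
    rw [hφ]; exact AdjoinRoot.lift_of hev
  have hsurj : Function.Surjective φ := fun s => by
    obtain ⟨r, rfl⟩ := Ideal.Quotient.mk_surjective s
    exact ⟨AdjoinRoot.of g r, hφof r⟩
  have hroot : AdjoinRoot.root g ^ d = AdjoinRoot.of g y := by
    have h := AdjoinRoot.eval₂_root g
    rwa [hg, eval₂_sub, eval₂_X_pow, eval₂_C, sub_eq_zero] at h
  have hker : RingHom.ker φ = Ideal.span {AdjoinRoot.root g} := by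
    apply le_antisymm
    · intro s hs
      obtain ⟨r, rfl⟩ := AdjoinRoot.mk_surjective s
      have hr : AdjoinRoot.mk g r =
          AdjoinRoot.mk g r.divX * AdjoinRoot.root g + AdjoinRoot.of g (r.coeff 0) := by
        conv_lhs => rw [← divX_mul_X_add r]
        rw [map_add, map_mul, AdjoinRoot.mk_X, AdjoinRoot.mk_C]
      rw [RingHom.mem_ker, hr, map_add, map_mul, hφ, AdjoinRoot.lift_root, mul_zero, zero_add,
        ← hφ, hφof, Ideal.Quotient.eq_zero_iff_mem, Ideal.mem_span_singleton'] at hs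
      obtain ⟨c, hc⟩ := hs
      rw [hr]
      refine Ideal.add_mem _ (Ideal.mul_mem_left _ _ (Ideal.mem_span_singleton_self _)) ?_
      rw [← hc, map_mul, ← hroot]
      exact Ideal.mul_mem_left _ _
        (Ideal.pow_mem_of_mem _ (Ideal.mem_span_singleton_self _) d hd)
    · rw [Ideal.span_le, Set.singleton_subset_iff, SetLike.mem_coe, RingHom.mem_ker, hφ]
      exact AdjoinRoot.lift_root hev
  exact ⟨(Ideal.quotEquivOfEq hker.symm).trans (RingHom.quotientKerEquivOfSurjective hsurj)⟩

/-- **Kummer covering along a regular parameter.** If `R` is a regular local ring, `y ∈ 𝔪_R`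
is nonzero with `R/(y)` regular (`y ∉ 𝔪²`) and `d ≥ 1`, then `B = R[Z]/(Z^d - y)` is a regular
local ring: it is local (`AdjoinRoot.isLocalRing_and_maximalIdeal_eq`), `z` is a non-zero-divisor
(`z^d = y` is one on the free `R`-module `B`) and `B/(z) ≅ R/(y)` is regular.
[cite: Matsumura1987, Thm. 14.2] -/
theorem isRegularLocalRing_adjoinRoot_X_pow_sub_C_of_quotient [IsRegularLocalRing R] {y : R}
    (hy : y ∈ maximalIdeal R) (hy0 : y ≠ 0) (hreg : IsRegularLocalRing (R ⧸ Ideal.span {y}))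
    {d : ℕ} (hd : 0 < d) : IsRegularLocalRing (AdjoinRoot (X ^ d - C y : R[X])) := by
  set g : R[X] := X ^ d - C y with hg
  obtain ⟨hloc, hmax⟩ := AdjoinRoot.isLocalRing_and_maximalIdeal_eq hd hy
  have hmon : g.Monic := monic_X_pow_sub_C y hd.ne'
  haveI : Module.Free R (AdjoinRoot g) := Module.Free.of_basis (AdjoinRoot.powerBasis' hmon).basis
  haveI : IsDomain R := isDomain_of_isRegularLocalRing R
  have hzm : AdjoinRoot.root g ∈ maximalIdeal (AdjoinRoot g) := by
    rw [hmax]; exact Ideal.mem_sup_right (Ideal.mem_span_singleton_self _)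
  have hroot : AdjoinRoot.root g ^ d = AdjoinRoot.of g y := by
    have h := AdjoinRoot.eval₂_root g
    rwa [hg, eval₂_sub, eval₂_X_pow, eval₂_C, sub_eq_zero] at h
  have hyreg : IsSMulRegular (AdjoinRoot g) y :=
    Module.Flat.isSMulRegular_of_nonZeroDivisors (mem_nonZeroDivisors_of_ne_zero hy0)
  have hzdreg : IsSMulRegular (AdjoinRoot g) (AdjoinRoot.root g ^ d) := by
    rw [hroot]
    intro b c hbc
    refine hyreg ?_
    simp only [smul_eq_mul] at hbc
    simpa only [Algebra.smul_def, AdjoinRoot.algebraMap_eq] using hbc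
  have hzreg : IsSMulRegular (AdjoinRoot g) (AdjoinRoot.root g) := by
    obtain ⟨e, he⟩ := Nat.exists_eq_succ_of_ne_zero hd.ne'
    rw [he, pow_succ] at hzdreg; exact hzdreg.of_mul
  obtain ⟨e⟩ := nonempty_ringEquiv_adjoinRoot_quotient_root y hd
  haveI : IsRegularLocalRing (AdjoinRoot g ⧸ Ideal.span {AdjoinRoot.root g}) :=
    IsRegularLocalRing.of_ringEquiv e.symm
  exact IsRegularLocalRing.of_quotient_span_singleton hzm hzreg

variable {K : Type u} [Field K] [Algebra R K]

/-- **`R[Z]/(P) ≅ R[a] ⊆ K`** for `P` monic, `R[Z]/(P)` a domain, `R ⊆ K` and `P(a) = 0`: the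
evaluation map is injective since its kernel is a prime of the integral extension `R[Z]/(P) ⊇ R`
lying over `0`. The isomorphism sends `z` to `a`. [cite: Matsumura1987, Thm. 9.3] -/
theorem exists_algEquiv_adjoinRoot_adjoin_of_isDomain (hinj : Function.Injective (algebraMap R K))
    (P : R[X]) (hP : P.Monic) [IsDomain (AdjoinRoot P)] (a : K)
    (ha : P.eval₂ (algebraMap R K) a = 0) :
    ∃ e : AdjoinRoot P ≃ₐ[R] Algebra.adjoin R {a}, (e (AdjoinRoot.root P) : K) = a := by
  have hroot : P.eval₂ (Algebra.ofId R K : R →+* K) a = 0 := ha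
  haveI : Nontrivial R := (algebraMap R K).domain_nontrivial
  haveI : Module.Finite R (AdjoinRoot P) := (AdjoinRoot.powerBasis' hP).finite
  haveI : Algebra.IsIntegral R (AdjoinRoot P) := Algebra.IsIntegral.of_finite R _
  let ψ : AdjoinRoot P →ₐ[R] K := AdjoinRoot.liftAlgHom P (Algebra.ofId R K) a hroot
  have hψof : ∀ x : R, ψ (AdjoinRoot.of P x) = algebraMap R K x := fun x => by
    change AdjoinRoot.liftAlgHom P (Algebra.ofId R K) a hroot (AdjoinRoot.of P x) = _
    rw [AdjoinRoot.liftAlgHom_of]; try rfl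
  have hψroot : ψ (AdjoinRoot.root P) = a := by
    change AdjoinRoot.liftAlgHom P (Algebra.ofId R K) a hroot (AdjoinRoot.root P) = a
    rw [AdjoinRoot.liftAlgHom_root]
  have hker : RingHom.ker (ψ : AdjoinRoot P →+* K) = ⊥ := by
    refine Ideal.eq_bot_of_comap_eq_bot (R := R) ?_
    refine eq_bot_iff.mpr fun x hx => ?_
    rw [Ideal.mem_comap, RingHom.mem_ker, AdjoinRoot.algebraMap_eq] at hx
    have hx' : algebraMap R K x = 0 := by rw [← hψof]; exact hx
    exact (Ideal.mem_bot).mpr (hinj (by rw [hx', map_zero]))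
  have hψinj : Function.Injective ψ := fun x y hxy =>
    (RingHom.injective_iff_ker_eq_bot (ψ : AdjoinRoot P →+* K)).mpr hker hxy
  have hrange : ψ.range = Algebra.adjoin R {a} := by
    rw [Algebra.adjoin_singleton_eq_range_aeval]
    ext x
    constructor
    · rintro ⟨y, rfl⟩
      obtain ⟨g, rfl⟩ := AdjoinRoot.mk_surjective y
      exact ⟨g, by
        change aeval a g = AdjoinRoot.liftAlgHom P (Algebra.ofId R K) a hroot (AdjoinRoot.mk P g)
        rw [AdjoinRoot.liftAlgHom_mk, aeval_def]; rfl⟩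
    · rintro ⟨g, rfl⟩
      exact ⟨AdjoinRoot.mk P g, by
        change AdjoinRoot.liftAlgHom P (Algebra.ofId R K) a hroot (AdjoinRoot.mk P g) = aeval a g
        rw [AdjoinRoot.liftAlgHom_mk, aeval_def]; rfl⟩
  exact ⟨(AlgEquiv.ofInjective ψ hψinj).trans (Subalgebra.equivOfEq _ _ hrange), hψroot⟩

end Kummer

section ModelForm
variable {k K : Type} [Field k] [Field K] [Algebra k K]

/-- Elements of `𝔪_T · T[a″]` have positive value (copy from `SoloInformedTorsorExits`). -/
private theorem val_lt_one_of_mem_map (O : ValuationSubring K) {T : Subring K}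
    [IsLocalRing T] (hT : ∀ t : T, t ∈ maximalIdeal T → O.valuation (t : K) < 1)
    (S : Subalgebra T K) (hSO : ∀ s : S, O.valuation (s : K) ≤ 1)
    {s : S} (hs : s ∈ (maximalIdeal T).map (algebraMap T S)) : O.valuation (s : K) < 1 := by
  refine Submodule.span_induction (p := fun s _ => O.valuation ((s : S) : K) < 1) ?_ ?_ ?_ ?_ hs
  · rintro _ ⟨t, ht, rfl⟩; exact hT t ht
  · simp
  · exact fun x y _ _ hx hy => Valuation.map_add_lt _ hx hy
  · intro r x _ hx
    change O.valuation (((r * x : S) : K)) < 1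
    rw [Subalgebra.coe_mul, map_mul]
    calc O.valuation (r : K) * O.valuation ((x : S) : K)
        ≤ 1 * O.valuation ((x : S) : K) := mul_le_mul_of_nonneg_right (hSO r) zero_le
      _ < 1 := by rw [one_mul]; exact hx

/-- **A model from a good generator** `a′ ∈ O` with `S = T[a′]` regular and dominated by `O`
(`T` the local ring of `A₀` at the centre), `c ∈ T`, `a ∈ k[A₀, c, a′]`, `a′, c ∈ k(A₀, a)`:
`A := k[A₀, c, a′]` is a model `A₀ ⊆ A ∋ a` in `k(A₀, a) ∩ O` with local ring `S`. [folklore] -/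
theorem exists_model_of_adjoin_generator (O : ValuationSubring K) (A₀ : Subalgebra k K)
    (h₀ : A₀.toSubring ≤ O.toSubring) (hA₀fg : A₀.FG) {a a' c : K} (ha'O : a' ∈ O)
    (hc : c ∈ locAtCentre A₀.toSubring O)
    (hSreg : IsRegularLocalRing (Algebra.adjoin (locAtCentre A₀.toSubring O) {a'}))
    (hSunit : ∀ z ∈ Algebra.adjoin (locAtCentre A₀.toSubring O) {a'}, O.valuation z = 1 →
      z⁻¹ ∈ Algebra.adjoin (locAtCentre A₀.toSubring O) {a'})
    (haA : a ∈ Algebra.adjoin k (insert a' (insert c (A₀ : Set K))))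
    (ha'F : a' ∈ IntermediateField.adjoin k (insert a (A₀ : Set K)))
    (hcF : c ∈ IntermediateField.adjoin k (insert a (A₀ : Set K))) :
    ∃ (A : Subalgebra k K) (h : A.toSubring ≤ O.toSubring), A₀ ≤ A ∧ a ∈ A ∧ A.FG ∧
      (A : Set K) ⊆ IntermediateField.adjoin k (insert a (A₀ : Set K)) ∧
      IsRegularLocalRing (Localization.AtPrime ((maximalIdeal O).comap (Subring.inclusion h))) := by
  classical
  set T : Subring K := locAtCentre A₀.toSubring O with hTdef
  have hTO : T ≤ O.toSubring := locAtCentre_le h₀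
  set S : Subring K := (Algebra.adjoin T {a'}).toSubring with hSdef
  have hSO : S ≤ O.toSubring := by
    rw [hSdef, Algebra.adjoin_eq_ring_closure]
    refine Subring.closure_le.mpr ?_
    rintro x (⟨t, rfl⟩ | hx)
    · exact hTO t.2
    · rw [Set.mem_singleton_iff] at hx; rw [hx]; exact ha'O
  set A : Subalgebra k K := Algebra.adjoin k (insert a' (insert c (A₀ : Set K))) with hAdef
  have hA₀A : A₀ ≤ A := fun x hx =>
    Algebra.subset_adjoin (Set.mem_insert_of_mem a' (Set.mem_insert_of_mem c hx))
  have ha'A : a' ∈ A := Algebra.subset_adjoin (Set.mem_insert a' _)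
  have hcA : c ∈ A := Algebra.subset_adjoin (Set.mem_insert_of_mem a' (Set.mem_insert c _))
  have hA₀T : A₀.toSubring ≤ T := le_locAtCentre _ O
  have hTS : T ≤ S := fun t ht => (Algebra.adjoin T {a'}).algebraMap_mem ⟨t, ht⟩
  have ha'S : a' ∈ S := Algebra.self_mem_adjoin_singleton T a'
  have hAS : A.toSubring ≤ S := by
    rw [hAdef, Algebra.adjoin_eq_ring_closure]
    refine Subring.closure_le.mpr ?_
    rintro x (⟨c', rfl⟩ | hx)
    · exact hTS (hA₀T (A₀.algebraMap_mem c'))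
    · rcases hx with rfl | rfl | hx
      · exact ha'S
      · exact hTS hc
      · exact hTS (hA₀T hx)
  have hloc : locAtCentre A.toSubring O = S := by
    refine le_antisymm ?_ ?_
    · rintro _ ⟨y, hy, z, hz, hv, rfl⟩
      rw [div_eq_mul_inv]
      exact S.mul_mem (hAS hy) (hSunit z (hAS hz) hv)
    · rw [hSdef, Algebra.adjoin_eq_ring_closure]
      refine Subring.closure_le.mpr ?_
      rintro x (⟨t, rfl⟩ | hx)
      · exact locAtCentre_mono O (show A₀.toSubring ≤ A.toSubring from hA₀A) t.2
      · rw [Set.mem_singleton_iff] at hx; rw [hx]; exact le_locAtCentre _ O ha'A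
  have hAO : A.toSubring ≤ O.toSubring := (le_locAtCentre _ O).trans (hloc ▸ hSO)
  have hAfg : A.FG := by
    obtain ⟨s, hs⟩ := hA₀fg
    have h1 : Algebra.adjoin k (insert c (A₀ : Set K)) = Algebra.adjoin k ↑(insert c s) := by
      rw [Finset.coe_insert, ← hs, Algebra.adjoin_insert_adjoin]
    rw [hAdef, ← Algebra.adjoin_insert_adjoin, h1, Algebra.adjoin_insert_adjoin,
      ← Finset.coe_insert]
    exact Subalgebra.fg_adjoin_finset _
  have hAF : (A : Set K) ⊆ IntermediateField.adjoin k (insert a (A₀ : Set K)) := by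
    change A ≤ (IntermediateField.adjoin k (insert a (A₀ : Set K))).toSubalgebra
    rw [hAdef]
    refine Algebra.adjoin_le ?_
    intro x hx
    rw [SetLike.mem_coe, IntermediateField.mem_toSubalgebra]
    rcases hx with rfl | rfl | hx
    · exact ha'F
    · exact hcF
    · exact IntermediateField.subset_adjoin k _ (Set.mem_insert_of_mem a hx)
  have hregA : IsRegularLocalRing (locAtCentre A.toSubring O) := by rw [hloc]; exact hSreg
  exact ⟨A, hAO, hA₀A, haA, hAfg, hAF, (isRegularLocalRing_locAtCentre_iff hAO).mp hregA⟩

/-- **Lemma T₁ solves the core step at a one-parameter toroidal presentation**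
`a ^ p = q ^ p + w · x ^ b` (`q, w, x ∈ A₀`, `p ∤ b`, `w` a unit and `x ≠ 0` a non-unit of
`T = (A₀)_{𝔪_O ∩ A₀}` with `T/(x)` regular): the model `k[A₀, w⁻¹, a′]`, `a′ = (a - q)^α / x^β`
(`α b = β p + 1`), has local ring `T[a′] ≅ T[Z]/(Z^p - w^α x)`. [cite: Matsumura1987, Thm. 14.2] -/
theorem exists_model_of_toroidalPresentation₁ {p : ℕ} [hp : Fact p.Prime] [CharP K p]
    (O : ValuationSubring K) (A₀ : Subalgebra k K) (h₀ : A₀.toSubring ≤ O.toSubring)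
    (hA₀fg : A₀.FG) (hreg :
      IsRegularLocalRing (Localization.AtPrime ((maximalIdeal O).comap (Subring.inclusion h₀))))
    {a q w x : K} {b : ℕ} (hq : q ∈ A₀) (hw : w ∈ A₀) (hx : x ∈ A₀) (hpb : ¬ p ∣ b)
    (hvw : O.valuation w = 1) (hvx : O.valuation x < 1) (hx0 : x ≠ 0)
    (hf : a ^ p = q ^ p + w * x ^ b)
    (hxreg : IsRegularLocalRing (↥(locAtCentre A₀.toSubring O) ⧸
      Ideal.span {(⟨x, le_locAtCentre A₀.toSubring O hx⟩ : locAtCentre A₀.toSubring O)})) :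
    ∃ (A : Subalgebra k K) (h : A.toSubring ≤ O.toSubring), A₀ ≤ A ∧ a ∈ A ∧ A.FG ∧
      (A : Set K) ⊆ IntermediateField.adjoin k (insert a (A₀ : Set K)) ∧
      IsRegularLocalRing (Localization.AtPrime ((maximalIdeal O).comap (Subring.inclusion h))) := by
  classical
  set T : Subring K := locAtCentre A₀.toSubring O with hTdef
  haveI hT : IsRegularLocalRing T := (isRegularLocalRing_locAtCentre_iff h₀).mpr hreg
  have hTO : T ≤ O.toSubring := locAtCentre_le h₀
  obtain ⟨α, -, hα⟩ := Nat.exists_mul_mod_eq_one_of_coprime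
    ((Nat.Prime.coprime_iff_not_dvd hp.out).mpr hpb).symm hp.out.one_lt
  set β : ℕ := b * α / p with hβ
  have hαβ : b * α = β * p + 1 := by
    have h := Nat.div_add_mod (b * α) p
    rw [hα] at h
    rw [hβ]; linarith [h, mul_comm p (b * α / p)]
  have hw0 : w ≠ 0 := ne_zero_of_valuation_eq_one hvw
  set a₁ : K := a - q with ha₁def
  have ha₁ : a₁ ^ p = w * x ^ b := by
    rw [ha₁def, sub_pow_char (p := p) a q, hf]; ring
  set a' : K := a₁ ^ α / x ^ β with ha'def
  have hxβ : x ^ β ≠ 0 := pow_ne_zero β hx0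
  have ha' : a' ^ p = w ^ α * x := by
    have h1 : a' ^ p * x ^ (β * p) = w ^ α * x * x ^ (β * p) := by
      rw [ha'def, div_pow, ← pow_mul, ← pow_mul, mul_comm α p, pow_mul, ha₁, mul_pow, ← pow_mul,
        hαβ, div_mul_cancel₀ _ (pow_ne_zero _ hx0)]
      ring
    exact mul_right_cancel₀ (pow_ne_zero _ hx0) h1
  have ha₁eq : a₁ = a' ^ b * w⁻¹ ^ β := by
    have h1 : a' ^ b = a₁ * w ^ β := by
      rw [ha'def, div_pow, ← pow_mul, ← pow_mul, mul_comm α b, hαβ, pow_succ, mul_comm β p,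
        pow_mul, ha₁, mul_pow, ← pow_mul, div_eq_iff (pow_ne_zero _ hx0)]
      ring
    rw [h1, inv_pow, mul_assoc, mul_inv_cancel₀ (pow_ne_zero _ hw0), mul_one]
  have hwT : w ∈ T := le_locAtCentre _ O hw
  have hxT : x ∈ T := le_locAtCentre _ O hx
  set wT : T := ⟨w, hwT⟩ with hwTdef
  set xT : T := ⟨x, hxT⟩ with hxTdef
  set yT : T := wT ^ α * xT with hyTdef
  have hyK : ((yT : T) : K) = w ^ α * x := by rw [hyTdef]; rfl
  have hwunit : IsUnit wT := by
    by_contra h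
    have h' := (not_isUnit_locAtCentre_iff h₀ wT).mp h
    exact absurd hvw (show O.valuation ((wT : T) : K) ≠ 1 from h'.ne)
  have hvy : O.valuation (w ^ α * x) < 1 := by
    rw [map_mul, map_pow, hvw, one_pow, one_mul]; exact hvx
  have hy : yT ∈ maximalIdeal T :=
    (mem_maximalIdeal _).mpr ((not_isUnit_locAtCentre_iff h₀ yT).mpr (by rw [hyK]; exact hvy))
  have hy0 : yT ≠ 0 := fun h =>
    (mul_ne_zero (pow_ne_zero α hw0) hx0) (hyK ▸ (congrArg Subtype.val h : ((yT : T) : K) = 0))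
  have hspan : Ideal.span {yT} = Ideal.span {xT} := by
    rw [hyTdef]; exact Ideal.span_singleton_mul_left_unit (hwunit.pow α) xT
  haveI hTy : IsRegularLocalRing (T ⧸ Ideal.span {yT}) :=
    IsRegularLocalRing.of_ringEquiv (Ideal.quotEquivOfEq hspan.symm)
  haveI hB : IsRegularLocalRing (AdjoinRoot (X ^ p - C yT : T[X])) :=
    isRegularLocalRing_adjoinRoot_X_pow_sub_C_of_quotient hy hy0 hTy hp.out.pos
  haveI : IsDomain (AdjoinRoot (X ^ p - C yT : T[X])) := isDomain_of_isRegularLocalRing _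
  have hinj : Function.Injective (algebraMap T K) := fun s t hst => Subtype.ext hst
  have hev : (X ^ p - C yT : T[X]).eval₂ (algebraMap T K) a' = 0 := by
    rw [eval₂_sub, eval₂_X_pow, eval₂_C, ha', sub_eq_zero, ← hyK]; rfl
  obtain ⟨e, he⟩ := exists_algEquiv_adjoinRoot_adjoin_of_isDomain hinj _
    (monic_X_pow_sub_C yT hp.out.ne_zero) a' hev
  haveI hSreg : IsRegularLocalRing (Algebra.adjoin T {a'}) :=
    IsRegularLocalRing.of_ringEquiv e.toRingEquiv
  have hva' : O.valuation a' < 1 := by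
    by_contra hle; rw [not_lt] at hle
    have h1 : 1 ≤ O.valuation (a' ^ p) := by rw [map_pow]; exact one_le_pow₀ hle
    exact (not_le.mpr hvy) (ha' ▸ h1)
  have ha'O : a' ∈ O := (O.valuation_le_one_iff a').mp hva'.le
  have hSO : ∀ s : Algebra.adjoin T {a'}, O.valuation (s : K) ≤ 1 := by
    intro s
    refine (O.valuation_le_one_iff _).mpr ?_
    have hs := s.2
    rw [← Subalgebra.mem_toSubring, Algebra.adjoin_eq_ring_closure] at hs
    refine Subring.closure_le.mpr ?_ hs
    rintro x (⟨t, rfl⟩ | hx)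
    · exact hTO t.2
    · rw [Set.mem_singleton_iff] at hx; rw [hx]; exact ha'O
  obtain ⟨hlocB, hmaxB⟩ := AdjoinRoot.isLocalRing_and_maximalIdeal_eq
    (A := T) (y := yT) hp.out.pos hy
  have hSunit : ∀ z ∈ Algebra.adjoin T {a'}, O.valuation z = 1 →
      z⁻¹ ∈ Algebra.adjoin T {a'} := by
    intro z hz hvz
    set zS : Algebra.adjoin T {a'} := ⟨z, hz⟩ with hzSdef
    by_cases hzu : IsUnit zS
    · obtain ⟨u, hu⟩ := hzu
      have hmul : z * ((↑(u⁻¹) : Algebra.adjoin T {a'}) : K) = 1 := by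
        have := congrArg (fun t : Algebra.adjoin T {a'} => (t : K)) u.mul_inv
        simpa [hu] using this
      rw [← eq_inv_of_mul_eq_one_right hmul]
      exact (↑(u⁻¹) : Algebra.adjoin T {a'}).2
    · exfalso
      have hmem : zS ∈ maximalIdeal (Algebra.adjoin T {a'}) := (mem_maximalIdeal _).mpr hzu
      rw [← map_ringEquiv_maximalIdeal e.toRingEquiv] at hmem
      have hmem' : zS ∈ (maximalIdeal (AdjoinRoot (X ^ p - C yT : T[X]))).map
          (e.toRingEquiv : AdjoinRoot (X ^ p - C yT : T[X]) →+* Algebra.adjoin T {a'}) := by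
        convert hmem using 2; rfl
      rw [hmaxB, Ideal.map_sup, Ideal.map_map, Ideal.map_span, Set.image_singleton] at hmem'
      obtain ⟨m, hm, n, hn, hmn⟩ := Submodule.mem_sup.mp hmem'
      obtain ⟨c', rfl⟩ := Ideal.mem_span_singleton'.mp hn
      have hT' : ∀ t : T, t ∈ maximalIdeal T → O.valuation (t : K) < 1 := fun t ht =>
        (not_isUnit_locAtCentre_iff h₀ t).mp ((mem_maximalIdeal _).mp ht)
      have hcomp :
          ((e.toRingEquiv : AdjoinRoot (X ^ p - C yT : T[X]) →+* Algebra.adjoin T {a'}).comp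
            (AdjoinRoot.of (X ^ p - C yT : T[X]))) = algebraMap T (Algebra.adjoin T {a'}) :=
        RingHom.ext fun t => e.commutes t
      rw [hcomp] at hm
      have hvm : O.valuation ((m : Algebra.adjoin T {a'}) : K) < 1 :=
        val_lt_one_of_mem_map O hT' (Algebra.adjoin T {a'}) hSO hm
      have hroot : (((e.toRingEquiv : AdjoinRoot (X ^ p - C yT : T[X]) →+* Algebra.adjoin T {a'})
          (AdjoinRoot.root (X ^ p - C yT : T[X])) : Algebra.adjoin T {a'}) : K) = a' := he
      have hvn : O.valuation (((c' * (e.toRingEquiv : AdjoinRoot (X ^ p - C yT : T[X]) →+*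
          Algebra.adjoin T {a'}) (AdjoinRoot.root (X ^ p - C yT : T[X])) :
            Algebra.adjoin T {a'}) : K)) < 1 := by
        rw [Subalgebra.coe_mul, map_mul, hroot]
        calc O.valuation (c' : K) * O.valuation a'
            ≤ 1 * O.valuation a' := mul_le_mul_of_nonneg_right (hSO c') zero_le
          _ < 1 := by rw [one_mul]; exact hva'
      have hlt : O.valuation ((zS : Algebra.adjoin T {a'}) : K) < 1 := by
        rw [← hmn, Subalgebra.coe_add]
        exact Valuation.map_add_lt _ hvm hvn
      exact (hlt : O.valuation z < 1).ne hvz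
  have hwinvT : w⁻¹ ∈ T := inv_mem_locAtCentre hwT hvw
  set F := IntermediateField.adjoin k (insert a (A₀ : Set K)) with hFdef
  have haF : a ∈ F := IntermediateField.subset_adjoin k _ (Set.mem_insert a _)
  have hA₀F : ∀ y ∈ A₀, y ∈ F := fun y hy =>
    IntermediateField.subset_adjoin k _ (Set.mem_insert_of_mem a hy)
  have ha'F : a' ∈ F := by
    rw [ha'def, ha₁def]
    exact div_mem (pow_mem (sub_mem haF (hA₀F q hq)) α) (pow_mem (hA₀F x hx) β)
  have hcF : w⁻¹ ∈ F := inv_mem (hA₀F w hw)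
  have haA : a ∈ Algebra.adjoin k (insert a' (insert w⁻¹ (A₀ : Set K))) := by
    have hsub : ∀ y ∈ insert a' (insert w⁻¹ (A₀ : Set K)),
        y ∈ Algebra.adjoin k (insert a' (insert w⁻¹ (A₀ : Set K))) := fun y hy =>
      Algebra.subset_adjoin hy
    rw [show a = q + a' ^ b * w⁻¹ ^ β by rw [← ha₁eq, ha₁def]; ring]
    exact add_mem (hsub q (Set.mem_insert_of_mem _ (Set.mem_insert_of_mem _ hq)))
      (mul_mem (pow_mem (hsub a' (Set.mem_insert _ _)) b)
        (pow_mem (hsub w⁻¹ (Set.mem_insert_of_mem _ (Set.mem_insert _ _))) β))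
  exact exists_model_of_adjoin_generator O A₀ h₀ hA₀fg ha'O hwinvT hSreg hSunit haA ha'F hcF

end ModelForm

end Summit.ResolutionOfSingularities.ResolutionOfSingularities.Theorems
end
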